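import Summits.Schanuel.Schanuel.Theorems.RootDecomp1KHyper64

/-!
# RootDecomp1KHyper — lens 6, generation 17 «BILOG STAIRCASE CELL» (BilogStair.lean edition 4 d7e974ba…, 3617 l; §K–§M) — continuation (RootDecomp1KHyper65): §L `isIntegral_gam_of_algebraic`, the typed algebraic pieces `InnerNormII` (UNDECIDED) and `ZeroTransferII`, and the reduction `transferII_of_pieces : InnerNormII → ZeroTransferII → TransferII` (PROVED; `maxHeartbeats 800000` as in the source)

(lens-6 g17 `BilogStair.lean` EDITION 4, sha256 d7e974ba…2880, 3617 l, own farm rc 0 · 0 warn · 0 sorry · axioms std; §A–§J = edition 2 (ported as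
`RootDecomp1KHyper53`–`62`), §K appended in edition 3 (critic ACK STATUS L1751: additive, reshape rule respected, PORT may proceed; L1762),
§L–§M appended in edition 4 (NODE/EDITION4 L1765, statement diff 0 removed / 0 changed / 20 added); port by census-1 gen 16 in parts
`RootDecomp1KHyper63`–`66` — 63 = §K `PB` closure lemmas + `piMeasure_fin1` + `caseII_outer_core`, 64 = §K `caseII_outer`, 65 = §L `InnerNormII` /
`ZeroTransferII` (Prop defs, typed pieces) + `transferII_of_pieces` (PROVED), 66 = §M `zeroTransferII_holds` (PROVED) + `transferII_of_innerNorm`.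
PORT edits: the source's `one_le_mvlen_of_ne_zero` is the tree's `RootDecomp1KHyper03.one_le_mvlen` (deleted, two call sites re-pointed);
`le_exp_self'` / `transcendental_pi_complex` / `exists_aeval_ne_zero` private (generic one-liners with tree twins; per-part private copies);
eleven one-line docstrings added; `set_option linter.dupNamespace false` dropped; statements and proofs otherwise verbatim.
INSTRUMENTS of record, NO credit (critic L1751/L1763: TransferI/TransferII remain typed UNDECIDED; TransferII proved as typed = one theorem credit).
`--supports stmt-Schanuel-33363`; nothing here proves Schanuel; rung 0.)
-/

open Complex Polynomial IntermediateField Filter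
open scoped BigOperators

namespace Summit.Schanuel.Schanuel.Theorems.RootDecomp1KHyper

namespace HyperCell

namespace LatCell

namespace Bilog

variable {n : ℕ}
open Summit.Schanuel.Schanuel.Theorems.RootDecomp1KRelLiouvilleCell (mvPolyMeasure_one_of_polyMeasure ycoeff
  mvaeval_cons_eq_sum mvlen_ycoeff_le natDegree_finSuccEquiv_le_totalDegree norm_mvaeval_le_mvlen_mul_pow)

/-! ## §L  TRANSFER II ⟸ INNER NORM ∧ CONJUGATE TRANSFER (two typed ALGEBRAIC pieces; the reduction PROVED)

With `caseII_outer` the analytic part of (II.exp) is done.  What is left is typed here as two pieces free of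
transcendence measures: `InnerNormII` (the norm `N_k = Res_T(minpoly γ_k, G(x₁, x₂, T)) ∈ ℤ[x₁, x₂]`: eventual
non-vanishing, degree `≤ H_k^c`, length `≤ exp(H_k^c)`, the value bound at `(π, r_k)` and the zero structure
«`N_k(π, x₂) = 0 ⟹ G(π, x₂, γ') = 0` for a conjugate `γ'` of `γ_k`») and `ZeroTransferII` (conjugate transfer: the
relations `Φ(π, ρ) = 0`, `G(π, pπ + qρ, γ') = 0` with `γ' ∼ γ` force `F(γ, p, q) = 0` for a FIXED `F ≠ 0` — generic
twisted resultant `Res_ρ(Φ(x₁, ρ), G(x₁, u x₁ + v ρ, T)) ∈ ℤ[x₁, u, v, T]`, `π ∉ ℚ̄`, `minpoly.dvd`).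
THEOREM `transferII_of_pieces : InnerNormII → ZeroTransferII → TransferII` (PROVED). -/

/-- `γ_k` is algebraic: `γ_k^{2 den(a_k) den(b_k)} = α^{2 den(a_k) num(b_k)}` with `α = e^{iℓ}` algebraic. -/
theorem isIntegral_gam_of_algebraic {ℓ : ℝ} {a b : ℕ → ℚ} (halg : IsAlgebraic ℚ (cexp ((ℓ : ℂ) * I)))
    (k : ℕ) : IsIntegral ℚ (gam ℓ a b k) := by
  rw [← isAlgebraic_iff_isIntegral]
  have hda : 0 < (a k).den := (a k).den_pos
  have hdb : 0 < (b k).den := (b k).den_pos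
  set n : ℕ := 2 * (a k).den * (b k).den with hn
  have hn0 : 0 < n := by positivity
  refine IsAlgebraic.of_pow hn0 ?_
  have hna : ((n : ℚ)) * a k = 2 * (b k).den * (a k).num := by
    rw [hn]; push_cast
    have := Rat.mul_den_eq_num (a k)
    linear_combination (2 * ((b k).den : ℚ)) * this
  have hnb : ((n : ℚ)) * b k = 2 * (a k).den * (b k).num := by
    rw [hn]; push_cast
    have := Rat.mul_den_eq_num (b k)
    linear_combination (2 * ((a k).den : ℚ)) * this
  have hpow : gam ℓ a b k ^ n = cexp ((ℓ : ℂ) * I) ^ (2 * ((a k).den : ℤ) * (b k).num) := by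
    unfold gam
    rw [← Complex.exp_nat_mul, ← Complex.exp_int_mul]
    have h1 : (n : ℂ) * ((((a k : ℝ) * Real.pi + (b k : ℝ) * ℓ : ℝ) : ℂ) * I) =
        (((b k).den * (a k).num : ℤ) : ℂ) * (2 * Real.pi * I) +
          ((2 * ((a k).den : ℤ) * (b k).num : ℤ) : ℂ) * ((ℓ : ℂ) * I) := by
      have hna' : ((n : ℂ)) * (a k : ℂ) = 2 * (b k).den * (a k).num := by exact_mod_cast hna
      have hnb' : ((n : ℂ)) * (b k : ℂ) = 2 * (a k).den * (b k).num := by exact_mod_cast hnb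
      push_cast
      linear_combination ((Real.pi : ℂ) * I) * hna' + ((ℓ : ℂ) * I) * hnb'
    rw [h1, Complex.exp_add, Complex.exp_int_mul_two_pi_mul_I, one_mul]
  rw [hpow]
  set m : ℤ := 2 * ((a k).den : ℤ) * (b k).num with hm
  rcases Int.eq_nat_or_neg m with ⟨j, hj | hj⟩
  · rw [hj, zpow_natCast]; exact halg.pow j
  · rw [hj, zpow_neg, zpow_natCast]; exact (halg.pow j).inv

/-- **INNER NORM** (piece of (II.exp), typed — UNDECIDED; algebraic number theory of `γ_k = e^{iπa_k} α^{b_k}`).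
For `G ≠ 0 ∈ ℤ[x₁, x₂, T]`: integer polynomials `N_k(x₁, x₂)` (intended: `Res_T(f_k(T), G(x₁, x₂, T))`, `f_k` the
primitive integer minimal polynomial of `γ_k`), eventually non-zero (degree growth), of degree `≤ H_k^c` and length
`≤ exp(H_k^c)` (conjugate data of `γ_k`), with `‖N_k(π, r_k)‖ ≤ exp(H_k^c)·‖G(π, r_k, γ_k)‖` at `r_k = a_kπ + b_kℓ`
(the other conjugate factors are `≤ exp(poly H_k)`) and whose zeros `N_k(π, x₂) = 0` come from `G(π, x₂, γ') = 0`
for a conjugate `γ'` of `γ_k` (product formula). -/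
def InnerNormII : Prop :=
  ∀ (ℓ : ℝ) (a b : ℕ → ℚ), IsAlgebraic ℚ (cexp ((ℓ : ℂ) * I)) → DegGrowth (gam ℓ a b) →
    (∀ᶠ k in atTop, 0 < b k) → ∀ G : MvPolynomial (Fin 3) ℤ, G ≠ 0 →
      ∃ (N : ℕ → MvPolynomial (Fin 2) ℤ) (c : ℕ),
        (∀ᶠ k in atTop, N k ≠ 0) ∧
        (∀ᶠ k in atTop, ((N k).totalDegree : ℝ) ≤ hgt a b k ^ c) ∧
        (∀ᶠ k in atTop, ((mvlen (N k) : ℤ) : ℝ) ≤ Real.exp (hgt a b k ^ c)) ∧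
        (∀ᶠ k in atTop,
          ‖MvPolynomial.aeval ![(Real.pi : ℂ), (a k : ℂ) * Real.pi + (b k : ℂ) * ℓ] (N k)‖ ≤
            Real.exp (hgt a b k ^ c) *
              ‖MvPolynomial.aeval ![(Real.pi : ℂ), (a k : ℂ) * Real.pi + (b k : ℂ) * ℓ, gam ℓ a b k] G‖) ∧
        (∀ᶠ k in atTop, ∀ x₂ : ℂ, MvPolynomial.aeval ![(Real.pi : ℂ), x₂] (N k) = 0 →
          ∃ γ' : ℂ, IsConjRoot ℚ (gam ℓ a b k) γ' ∧ MvPolynomial.aeval ![(Real.pi : ℂ), x₂, γ'] G = 0)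

/-- **CONJUGATE TRANSFER** (piece of (II.exp), typed — UNDECIDED; algebra and `π ∉ ℚ̄`).  For `Φ ≠ 0`, `G ≠ 0`
there is a FIXED `F ≠ 0 ∈ ℤ[T, u, v]` such that `Φ(π, ρ) = 0 ∧ G(π, pπ + qρ, γ') = 0` with `γ'` conjugate to the
algebraic `γ` forces `F(γ, p, q) = 0`.  Blueprint: `𝓡 := Res_ρ(Φ(x₁, ρ), G(x₁, u x₁ + v ρ, T)) ∈ ℤ[x₁, u, v, T]` is
`≠ 0` (the substitution `x₂ ↦ u x₁ + v ρ̂` is injective on `ℚ(x₁)^{alg}[x₂, T]`), `𝓡(π, p, q, γ') = 0` (common root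
`ρ`), so every `x₁`-coefficient `𝓡_i(p, q, γ')` vanishes (`π` transcendental over `ℚ̄`), hence `𝓡_i(p, q, γ) = 0`
(`minpoly.dvd`); `F := 𝓡_{i₀} ≠ 0`. -/
def ZeroTransferII : Prop :=
  ∀ Φ : MvPolynomial (Fin 2) ℤ, Φ ≠ 0 → ∀ G : MvPolynomial (Fin 3) ℤ, G ≠ 0 →
    ∃ F : MvPolynomial (Fin 3) ℤ, F ≠ 0 ∧
      ∀ (p q : ℚ) (ρ γ γ' : ℂ), IsIntegral ℚ γ → IsConjRoot ℚ γ γ' →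
        MvPolynomial.aeval ![(Real.pi : ℂ), ρ] Φ = 0 →
        MvPolynomial.aeval ![(Real.pi : ℂ), (p : ℂ) * Real.pi + (q : ℂ) * ρ, γ'] G = 0 →
        MvPolynomial.aeval ![γ, (p : ℂ), (q : ℂ)] F = 0

open Summit.Schanuel.Schanuel.Theorems.RootDecomp1KGeneric (norm_mvAeval_sub_le norm_cexp_sub_cexp_le lenMv
  lenMv_nonneg) in
set_option maxHeartbeats 800000 in
/-- **TRANSFER II from the two algebraic pieces (PROVED).**  `InnerNormII → ZeroTransferII → TransferII`:
the hyper-approximation makes `‖G(π, r_k, γ_k)‖`, hence `‖N_k(π, r_k)‖`, hyper-small (Lipschitz bound, tree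
`norm_mvAeval_sub_le`); `caseII_outer` then puts a zero of `N_k(π, ·)` at `a_kπ + b_kρ`, `Φ(π, ρ) = 0`; the zero
structure gives `G(π, a_kπ + b_kρ, γ') = 0` for a conjugate `γ'`, and the conjugate transfer the fixed relation `F`. -/
theorem transferII_of_pieces (hIN : InnerNormII) (hZT : ZeroTransferII) : TransferII := by
  classical
  intro ℓ y a b halg hS hdeg hb Φ hΦ hΦ0 G hG hG0
  obtain ⟨N, c, hN0, hNdeg, hNlen, hNval, hNzero⟩ := hIN ℓ a b halg hdeg hb G hG
  obtain ⟨F, hF0, hF⟩ := hZT Φ hΦ G hG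
  refine ⟨F, hF0, ?_⟩
  -- the staircase points `r_k` and `γ_k = e^{i r_k}`
  obtain ⟨r, hr⟩ : ∃ r : ℕ → ℝ, r = fun k => (a k : ℝ) * Real.pi + (b k : ℝ) * ℓ := ⟨_, rfl⟩
  have hrC : ∀ k, ((r k : ℝ) : ℂ) = (a k : ℂ) * Real.pi + (b k : ℂ) * ℓ := fun k => by
    rw [hr]; push_cast; rfl
  have hgam : ∀ k, gam ℓ a b k = cexp ((r k : ℂ) * I) := fun k => by rw [hr]; rfl
  have hclose : ∀ᶠ k in atTop, |y - r k| < 1 := (hS 0).mono fun k hk => by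
    rw [hr]; dsimp only
    refine hk.trans_le ?_
    rw [pow_zero]
    exact (Real.exp_lt_one_iff.mpr (by norm_num)).le
  -- Lipschitz: ‖G(π, r_k, γ_k)‖ ≤ L₀ · |y − r_k|
  set E := G.totalDegree with hE
  have hEs : ∀ s ∈ G.support, ∀ i, s i ≤ E := fun s hs i =>
    (MvPolynomial.monomial_le_degreeOf i hs).trans (MvPolynomial.degreeOf_le_totalDegree G i)
  obtain ⟨R, hR⟩ : ∃ R : ℝ, R = |y| + Real.pi + 2 := ⟨_, rfl⟩
  have hR1 : 1 ≤ R := by rw [hR]; linarith [abs_nonneg y, Real.pi_pos]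
  obtain ⟨L₀, hL₀⟩ : ∃ L₀ : ℝ, L₀ = ((lenMv G : ℤ) : ℝ) * ((E : ℝ) * R ^ (3 * E) * 3) := ⟨_, rfl⟩
  have hGsmall : ∀ᶠ k in atTop,
      ‖MvPolynomial.aeval ![(Real.pi : ℂ), (a k : ℂ) * Real.pi + (b k : ℂ) * ℓ, gam ℓ a b k] G‖ ≤
        L₀ * |y - r k| := hclose.mono fun k hk => by
    have hxy : ∀ i : Fin 3, ‖(![(Real.pi : ℂ), ((r k : ℝ) : ℂ), cexp ((r k : ℂ) * I)] : Fin 3 → ℂ) i‖ ≤ R ∧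
        ‖(![(Real.pi : ℂ), (y : ℂ), cexp ((y : ℂ) * I)] : Fin 3 → ℂ) i‖ ≤ R := by
      intro i
      match i with
      | 0 => simp only [Matrix.cons_val_zero, Complex.norm_real, Real.norm_eq_abs, abs_of_pos Real.pi_pos]
             constructor <;> (rw [hR]; linarith [abs_nonneg y])
      | 1 => simp only [Matrix.cons_val_one, Matrix.cons_val_zero, Complex.norm_real, Real.norm_eq_abs]
             have : |r k| ≤ |y| + 1 := by
               have := abs_sub_abs_le_abs_sub (r k) y
               rw [abs_sub_comm] at hk
               linarith
             constructor <;> (rw [hR]; linarith [Real.pi_pos, abs_nonneg y])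
      | 2 => simp only [Matrix.cons_val_two, Matrix.tail_cons, Matrix.head_cons, Complex.norm_exp_ofReal_mul_I]
             exact ⟨hR1, hR1⟩
    have h1 := norm_mvAeval_sub_le G hEs hR1 _ _ (fun i => (hxy i).1) (fun i => (hxy i).2)
    rw [hG0, sub_zero, Fin.sum_univ_three] at h1
    simp only [Matrix.cons_val_zero, Matrix.cons_val_one, Matrix.cons_val_two, Matrix.tail_cons,
      Matrix.head_cons, sub_self, norm_zero, zero_add] at h1
    have h2 : ‖((r k : ℝ) : ℂ) - (y : ℂ)‖ = |y - r k| := by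
      rw [show ((r k : ℝ) : ℂ) - (y : ℂ) = (((r k - y : ℝ)) : ℂ) by push_cast; ring, Complex.norm_real,
        Real.norm_eq_abs, abs_sub_comm]
    have h3 : ‖cexp ((r k : ℂ) * I) - cexp ((y : ℂ) * I)‖ ≤ 2 * |y - r k| := by
      have hd : ‖(r k : ℂ) * I - (y : ℂ) * I‖ = |y - r k| := by
        rw [← sub_mul, norm_mul, Complex.norm_I, mul_one, h2]
      have := norm_cexp_sub_cexp_le (a := (r k : ℂ) * I) (b := (y : ℂ) * I) (by rw [hd]; exact hk.le)
      rwa [Complex.norm_exp_ofReal_mul_I, one_mul, hd] at this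
    have hlen0 : (0 : ℝ) ≤ ((lenMv G : ℤ) : ℝ) * ((E : ℝ) * R ^ (3 * E)) := by
      have h0 : (0 : ℝ) ≤ ((lenMv G : ℤ) : ℝ) := by exact_mod_cast lenMv_nonneg G
      positivity
    rw [← hrC k, hgam k]
    calc ‖MvPolynomial.aeval ![(Real.pi : ℂ), ((r k : ℝ) : ℂ), cexp ((r k : ℂ) * I)] G‖
        ≤ ((lenMv G : ℤ) : ℝ) * (↑E * R ^ (3 * E) * (‖((r k : ℝ) : ℂ) - (y : ℂ)‖ +
            ‖cexp ((r k : ℂ) * I) - cexp ((y : ℂ) * I)‖)) := h1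
      _ ≤ ((lenMv G : ℤ) : ℝ) * (↑E * R ^ (3 * E) * (|y - r k| + 2 * |y - r k|)) := by
          rw [h2]
          have := mul_le_mul_of_nonneg_left (add_le_add_left h3 (|y - r k|)) hlen0
          nlinarith [this]
      _ = L₀ * |y - r k| := by rw [hL₀]; ring
  -- hyper-smallness of `N_k(π, r_k)`
  have hsmall : ∀ m : ℕ, ∀ᶠ k in atTop,
      ‖MvPolynomial.aeval ![(Real.pi : ℂ), (a k : ℂ) * Real.pi + (b k : ℂ) * ℓ] (N k)‖ <
        Real.exp (-(hgt a b k) ^ m) := by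
    intro m
    obtain ⟨L₁, hL₁⟩ : ∃ L₁ : ℝ, L₁ = max L₀ 1 := ⟨_, rfl⟩
    have hL₁1 : 1 ≤ L₁ := by rw [hL₁]; exact le_max_right _ _
    have hL₁0 : 0 < L₁ := by linarith
    have hL₀1 : L₀ ≤ L₁ := by rw [hL₁]; exact le_max_left _ _
    have hδsmall : ∀ m' : ℕ, ∀ᶠ k in atTop, |y - r k| < Real.exp (-(hgt a b k) ^ m') := fun m' =>
      (hS m').mono fun k hk => by rw [hr]; exact hk
    have hcl := pb_clash (pb_add (pb_add (pb_pow_hgt (a := a) (b := b) c) (pb_const (Real.log L₁)))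
      (pb_pow_hgt m)) hδsmall (Filter.Eventually.of_forall fun k => abs_nonneg _)
    filter_upwards [hcl, hNval, hGsmall] with k h1 h2 h3
    have h4 : ‖MvPolynomial.aeval ![(Real.pi : ℂ), (a k : ℂ) * Real.pi + (b k : ℂ) * ℓ] (N k)‖ ≤
        Real.exp (hgt a b k ^ c) * (L₁ * |y - r k|) :=
      h2.trans (mul_le_mul_of_nonneg_left (h3.trans (mul_le_mul_of_nonneg_right hL₀1 (abs_nonneg _)))
        (Real.exp_pos _).le)
    rw [Real.exp_add, Real.exp_add, Real.exp_log hL₁0] at h1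
    have hexp : Real.exp (hgt a b k ^ m) * Real.exp (-(hgt a b k) ^ m) = 1 := by
      rw [← Real.exp_add, add_neg_cancel, Real.exp_zero]
    calc ‖MvPolynomial.aeval ![(Real.pi : ℂ), (a k : ℂ) * Real.pi + (b k : ℂ) * ℓ] (N k)‖
        ≤ Real.exp (hgt a b k ^ c) * (L₁ * |y - r k|) := h4
      _ = (Real.exp (hgt a b k ^ c) * L₁ * Real.exp (hgt a b k ^ m) * |y - r k|) *
            Real.exp (-(hgt a b k) ^ m) := by
          calc Real.exp (hgt a b k ^ c) * (L₁ * |y - r k|)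
              = Real.exp (hgt a b k ^ c) * (L₁ * |y - r k|) *
                  (Real.exp (hgt a b k ^ m) * Real.exp (-(hgt a b k) ^ m)) := by rw [hexp, mul_one]
            _ = _ := by ring
      _ < 1 * Real.exp (-(hgt a b k) ^ m) := mul_lt_mul_of_pos_right h1 (Real.exp_pos _)
      _ = Real.exp (-(hgt a b k) ^ m) := one_mul _
  -- the twisted elimination and the two algebraic pieces
  have hout := caseII_outer hb Φ hΦ hΦ0 N c hN0 hNdeg hNlen hsmall
  filter_upwards [hout, hNzero] with k hk hz
  obtain ⟨ρ, hΦρ, hNρ⟩ := hk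
  obtain ⟨γ', hconj, hGγ'⟩ := hz _ hNρ
  exact hF (a k) (b k) ρ (gam ℓ a b k) γ' (isIntegral_gam_of_algebraic halg k) hconj hΦρ hGγ'

end Bilog
end LatCell
end HyperCell
end Summit.Schanuel.Schanuel.Theorems.RootDecomp1KHyper
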